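import Summits.QuantumFields.YangMills.Theorems.UnitScaleTiltProp7SectET3DeltaEtaExplicitT3
import Summits.QuantumFields.YangMills.Theorems.UnitScaleTiltProp7RieszTauFrobNormT3
import Literature.MathematicalPhysics.QuantumFieldTheory.Balaban1983to89.B9Eq369Small
import HarnessLib

/-!
# Route `UnitScaleTilt`, crux K1 «MinimiserStabilityRegPr» (stmt-QuantumFields-19200) — route-R E′ (A′), RULING g28-№13 ∕ ACK 91 (3), T2 part 1∕2:
# **THE CURVATURE PART `Δ′` OF THE WILSON HESSIAN (3.10) IS `O(ε₀η²)` AS AN OPERATOR ON `L²`** — `|Σ_b tr(X_b†(Δ′₁X)_b)| ≤ 1029·ε₀η²·Σ_b‖X_b‖_F²` on `RegPr F n K ε₀ U₀`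

Cell `ym3-torus`, width seat `ym-ust-19200-w4` (gen 8); ★p1 g17 WORD 13 («almost-positivity of `Δ^η` … by w4's T2»).  THEOREMS ONLY (0 `def`, 0 `sorry`); `--supports stmt-QuantumFields-19200`,
count-neutral.  YM₃ on T³ is a ladder rung (R3), not the Clay problem; nothing here claims [Balaban1985BackgroundPropagators] Thm 3.3∕3.11, HESS, `hcoW`, E′, EX, the crux, d = 4 or the gap.

WHY.  The (A′) coercivity row of `Δ_a(W)` follows from an `L²` inverse bound and ALMOST-POSITIVITY of the Hessian letter (✓`Prop7CoerciveOfInverseBound`).  Print's (3.10) `Δ^η = D*D + Δ′`,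
«Δ′ will be a bounded, small operator» (p.392), is in the tree POINTWISE: ✓`Prop7SectET3DeltaEtaExplicit.norm_deltaPrimeOp_le_of_regPr` (`‖(Δ′₁X)(b)‖ ≤ 28·ε₀η²·sup‖X‖`).  A sup
letter does not bound a quadratic form in `L²`; the LOCAL letter does: lit ✓`B9Eq369Small.norm_deltaPrimeOp_le_local_one` ((3.69): «the supremum … over bonds belonging to one of the
plaquettes containing the bond b», p.404) with the local `ℓ²` size `a_b := (Σ_{p ∋ b} Σ_{b′∈∂p}‖X_{b′}‖²)^{1∕2}`, a DOUBLE COUNT `Σ_b a_b² ≤ 16d·Σ_b‖X_b‖²` (each plaquette is `Through`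
exactly its four boundary bonds), Cauchy–Schwarz per bond and AM–GM give the `L²` statement with an ABSOLUTE constant.

WHAT IS PROVED (ns `…Theorems.Prop7DeltaPrimeL2Bound`): `weights_le_of_regPr` (`‖z_p‖, ‖y_p‖ ≤ ε₀η²`, adapted from ✓`norm_deltaPrimeOp_le_of_regPr`), ★`norm_deltaPrimeOp_le_local_of_regPr`
(`‖(Δ′₁X)(b)‖ ≤ 28ε₀η²·a_b`), `sum_ite_and_eq_right`, ★★`sum_through_weights_le` (`Σ_b a_b² ≤ 16d·Σ_b‖X_b‖²`), `norm_trace_conjTranspose_mul_le`,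
★★★`norm_sum_trace_conjTranspose_mul_deltaPrimeOp_le` (`|Σ_b tr(X_b†(Δ′₁X)_b)| ≤ 1029·ε₀η²·Σ_b‖X_b‖_F²`).  Part 2∕2 (`…Prop7DeltaEtaAlmostPositive`) adds the `D*D ≥ 0` half and assembles
`re⟪y, Δ^η y⟫ ≥ −1029ε₀‖y‖²`.  HONEST SCOPE: elementary lattice bookkeeping over landed letters; constants not optimised; rung R3, not Clay; YM gap NOT proved.

References: T. Bałaban, CMP 99 (1985) 389–434 [Balaban1985BackgroundPropagators] ((3.9)–(3.12) p.392, (3.69) p.404); CMP 102 (1985) 277–309 [Balaban1985Variational] ((14) p.280, p.299).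
-/

set_option autoImplicit false

noncomputable section

open scoped Matrix.Norms.L2Operator BigOperators InnerProductSpace ComplexConjugate

namespace Summit.QuantumFields.YangMills.Theorems.Prop7DeltaPrimeL2Bound

open Literature.MathematicalPhysics.QuantumFieldTheory.Balaban1983to89
open Literature.MathematicalPhysics.QuantumFieldTheory.Balaban1983to89.T3ContinuumYM3Torus
open Literature.MathematicalPhysics.QuantumFieldTheory.Balaban1983to89.T3PrintedRegularMinimiser (RegPr)
open Literature.MathematicalPhysics.QuantumFieldTheory.Balaban1983to89.T3RegularMinimiser (regThreshold)
open T3SectALandauChart (formComp bgUnits eta eta_pos)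
open B9TorusCalculus (torusT)
open B9Eq37Insertion (reC imC)
open B9Eq39Adjoint (R plaqU)
open B9Eq310Hermitian (deltaPrimeOp zP yP plaqU_unitary)
open B9Eq369Small (Through norm_deltaPrimeOp_le_local_one)
open Summit.QuantumFields.YangMills.Theorems.Prop7SectET3HilbertLetters (W₂ frobEquiv inner_frobEquiv_symm)
open Summit.QuantumFields.YangMills.Theorems.Prop7SecondOrderDict (norm_bgUnits_le_one norm_plaqFT_bgUnits_sub_one_le val_plaqU_torusT_eq_plaqFT)
open Summit.QuantumFields.YangMills.Theorems.Prop7SectET3DeltaEtaExplicit (val_inv_bgUnits_eq_star sum_pbond_eq)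
open Summit.QuantumFields.YangMills.Theorems.Prop7RieszTauFrobNorm (norm_le_norm_frobEquiv_symm norm_frobEquiv_symm_le)

variable {F : T3Family} {n K : ℕ}

/-! ## §2 The curvature part `Δ′` is `O(ε₀η²)` as an OPERATOR ON `L²` (local letter + a double count over the plaquettes through a bond) -/

/-- **THE PLAQUETTE WEIGHTS ON THE PRINTED-REGULAR CLASS**: `‖z_p‖, ‖y_p‖ ≤ ε₀η²` at unit spacing for every positively oriented plaquette — the plaquette clause of `RegPr`
(`‖W_p − 1‖ ≤ ε₀η²`, ✓`norm_plaqFT_bgUnits_sub_one_le`), exactly as inside ✓`norm_deltaPrimeOp_le_of_regPr` (adapted from that proof).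
[cite: Balaban1985Variational, (14) p.280; Balaban1985BackgroundPropagators, (3.10) p.392, p.404] -/
theorem weights_le_of_regPr {ε₀ : ℝ} (U₀ : GaugeField (F.P K) 0 (Matrix.specialUnitaryGroup (Fin 2) ℂ)) (hreg : RegPr F n K ε₀ U₀) :
    (∀ μ ν y, μ < ν → ‖zP (torusT (F.P K) 0) (fun μ x => bgUnits F K U₀ ⟨x, μ⟩) 1 μ ν y‖ ≤ ε₀ * eta F n K ^ 2) ∧
    (∀ μ ν y, μ < ν → ‖yP (torusT (F.P K) 0) (fun μ x => bgUnits F K U₀ ⟨x, μ⟩) 1 μ ν y‖ ≤ ε₀ * eta F n K ^ 2) := by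
  set T := torusT (F.P K) 0 with hT
  set U : Fin (F.P K).d → Site (F.P K) 0 → (Matrix (Fin 2) (Fin 2) ℂ)ˣ := fun μ x => bgUnits F K U₀ ⟨x, μ⟩ with hU
  have hUu : ∀ μ x, (((U μ x)⁻¹ : (Matrix (Fin 2) (Fin 2) ℂ)ˣ) : Matrix (Fin 2) (Fin 2) ℂ) = star (U μ x : Matrix (Fin 2) (Fin 2) ℂ) :=
    fun μ x => by rw [hU]; exact val_inv_bgUnits_eq_star U₀ μ x
  have hδ : regThreshold F n K ε₀ = ε₀ * eta F n K ^ 2 := by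
    rw [regThreshold, eta, ← pow_mul, mul_comm 2 (K - n)]
  have hW : ∀ μ ν y, μ < ν → ‖(plaqU T U μ ν y : Matrix (Fin 2) (Fin 2) ℂ) - 1‖ ≤ ε₀ * eta F n K ^ 2 := by
    intro μ ν y hμν
    rw [hT, hU, val_plaqU_torusT_eq_plaqFT, ← hδ]
    exact norm_plaqFT_bgUnits_sub_one_le F K U₀ hreg.plaqSmall μ ν y hμν.ne
  have hWinv : ∀ μ ν y, μ < ν → ‖(((plaqU T U μ ν y)⁻¹ : (Matrix (Fin 2) (Fin 2) ℂ)ˣ) : Matrix (Fin 2) (Fin 2) ℂ) - 1‖ ≤ ε₀ * eta F n K ^ 2 := by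
    intro μ ν y hμν
    rw [plaqU_unitary T U hUu, ← star_one (R := Matrix (Fin 2) (Fin 2) ℂ), ← star_sub, norm_star]
    exact hW μ ν y hμν
  refine ⟨fun μ ν y hμν => ?_, fun μ ν y hμν => ?_⟩
  · rw [zP, Complex.ofReal_one, inv_one, one_pow, one_smul, reC]
    have hrw : (2 : ℂ)⁻¹ • ((plaqU T U μ ν y : Matrix (Fin 2) (Fin 2) ℂ) + (((plaqU T U μ ν y)⁻¹ : (Matrix (Fin 2) (Fin 2) ℂ)ˣ) : Matrix (Fin 2) (Fin 2) ℂ)) - 1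
        = (2 : ℂ)⁻¹ • (((plaqU T U μ ν y : Matrix (Fin 2) (Fin 2) ℂ) - 1) + ((((plaqU T U μ ν y)⁻¹ : (Matrix (Fin 2) (Fin 2) ℂ)ˣ) : Matrix (Fin 2) (Fin 2) ℂ) - 1)) := by
      rw [smul_add, smul_add, smul_sub, smul_sub]
      have h2 : (2 : ℂ)⁻¹ • (1 : Matrix (Fin 2) (Fin 2) ℂ) + (2 : ℂ)⁻¹ • (1 : Matrix (Fin 2) (Fin 2) ℂ) = 1 := by
        rw [← add_smul]; norm_num
      linear_combination (norm := module) -h2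
    rw [hrw, norm_smul]
    have hhalf : ‖(2 : ℂ)⁻¹‖ = 2⁻¹ := by simp
    rw [hhalf]
    calc 2⁻¹ * ‖((plaqU T U μ ν y : Matrix (Fin 2) (Fin 2) ℂ) - 1) + ((((plaqU T U μ ν y)⁻¹ : (Matrix (Fin 2) (Fin 2) ℂ)ˣ) : Matrix (Fin 2) (Fin 2) ℂ) - 1)‖
        ≤ 2⁻¹ * (ε₀ * eta F n K ^ 2 + ε₀ * eta F n K ^ 2) := by
          gcongr
          exact (norm_add_le _ _).trans (add_le_add (hW μ ν y hμν) (hWinv μ ν y hμν))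
      _ = ε₀ * eta F n K ^ 2 := by ring
  · rw [yP, Complex.ofReal_one, inv_one, one_pow, one_smul, B9Eq37Insertion.imC_eq]
    have hrw : ((plaqU T U μ ν y : Matrix (Fin 2) (Fin 2) ℂ) - (((plaqU T U μ ν y)⁻¹ : (Matrix (Fin 2) (Fin 2) ℂ)ˣ) : Matrix (Fin 2) (Fin 2) ℂ))
        = ((plaqU T U μ ν y : Matrix (Fin 2) (Fin 2) ℂ) - 1) - ((((plaqU T U μ ν y)⁻¹ : (Matrix (Fin 2) (Fin 2) ℂ)ˣ) : Matrix (Fin 2) (Fin 2) ℂ) - 1) := by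
      abel
    rw [hrw, norm_smul]
    have hhalf : ‖(-(Complex.I / 2) : ℂ)‖ = 2⁻¹ := by simp
    rw [hhalf]
    calc 2⁻¹ * ‖((plaqU T U μ ν y : Matrix (Fin 2) (Fin 2) ℂ) - 1) - ((((plaqU T U μ ν y)⁻¹ : (Matrix (Fin 2) (Fin 2) ℂ)ˣ) : Matrix (Fin 2) (Fin 2) ℂ) - 1)‖
        ≤ 2⁻¹ * (ε₀ * eta F n K ^ 2 + ε₀ * eta F n K ^ 2) := by
          gcongr
          exact (norm_sub_le _ _).trans (add_le_add (hW μ ν y hμν) (hWinv μ ν y hμν))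
      _ = ε₀ * eta F n K ^ 2 := by ring

open Classical in
/-- **THE LOCAL LETTER AT THE MEMBER**: `‖(Δ′₁X)(b)‖ ≤ 28·ε₀η²·a_b` with the LOCAL size `a_b := (Σ_{p ∋ b} Σ_{b′ ∈ ∂p} ‖X_{b′}‖²)^{1∕2}` (sum over the positively oriented plaquettes
`p` through `b`, lit's `Through`, and their four boundary letters) — lit ✓`norm_deltaPrimeOp_le_local_one` ((3.69)) on `RegPr`: «the supremum on the right-hand side is taken over bonds
belonging to one of the plaquettes containing the bond b» (p.404), with the sup replaced by the local `ℓ²` size. [cite: Balaban1985BackgroundPropagators, (3.69) p.404, (3.10) p.392] -/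
theorem norm_deltaPrimeOp_le_local_of_regPr {ε₀ : ℝ} (U₀ : GaugeField (F.P K) 0 (Matrix.specialUnitaryGroup (Fin 2) ℂ)) (hreg : RegPr F n K ε₀ U₀)
    (X : PBond (F.P K) 0 → Matrix (Fin 2) (Fin 2) ℂ) (μ : Fin (F.P K).d) (x : Site (F.P K) 0) :
    ‖deltaPrimeOp (torusT (F.P K) 0) (fun μ x => bgUnits F K U₀ ⟨x, μ⟩) 1 (formComp X) μ x‖
      ≤ 28 * (ε₀ * eta F n K ^ 2) *
        Real.sqrt (∑ κ : Fin (F.P K).d, ∑ ν : Fin (F.P K).d, ∑ y : Site (F.P K) 0,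
          if Through (torusT (F.P K) 0) μ x κ ν y then
            ‖X ⟨y, κ⟩‖ ^ 2 + ‖X ⟨torusT (F.P K) 0 κ y, ν⟩‖ ^ 2 + ‖X ⟨torusT (F.P K) 0 ν y, κ⟩‖ ^ 2 + ‖X ⟨y, ν⟩‖ ^ 2
          else 0) := by
  set T := torusT (F.P K) 0 with hT
  set U : Fin (F.P K).d → Site (F.P K) 0 → (Matrix (Fin 2) (Fin 2) ℂ)ˣ := fun μ x => bgUnits F K U₀ ⟨x, μ⟩ with hU
  set w : Fin (F.P K).d → Fin (F.P K).d → Site (F.P K) 0 → ℝ :=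
    fun κ ν y => ‖X ⟨y, κ⟩‖ ^ 2 + ‖X ⟨T κ y, ν⟩‖ ^ 2 + ‖X ⟨T ν y, κ⟩‖ ^ 2 + ‖X ⟨y, ν⟩‖ ^ 2 with hw
  set S : ℝ := ∑ κ : Fin (F.P K).d, ∑ ν : Fin (F.P K).d, ∑ y : Site (F.P K) 0, if Through T μ x κ ν y then w κ ν y else 0 with hS
  have hU1 : ∀ μ x, ‖(U μ x : Matrix (Fin 2) (Fin 2) ℂ)‖ ≤ 1 ∧ ‖(((U μ x)⁻¹ : (Matrix (Fin 2) (Fin 2) ℂ)ˣ) : Matrix (Fin 2) (Fin 2) ℂ)‖ ≤ 1 :=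
    fun μ x => norm_bgUnits_le_one F K U₀ ⟨x, μ⟩
  obtain ⟨hz, hy⟩ := weights_le_of_regPr U₀ hreg
  have hw0 : ∀ κ ν y, 0 ≤ w κ ν y := fun κ ν y => by positivity
  have hS0 : 0 ≤ S := Finset.sum_nonneg fun κ _ => Finset.sum_nonneg fun ν _ => Finset.sum_nonneg fun y _ => by
    split_ifs
    · exact hw0 κ ν y
    · exact le_rfl
  -- each of the four letters of a plaquette through `b` is bounded by `√S`
  have hle : ∀ κ ν y, Through T μ x κ ν y → w κ ν y ≤ S := by
    intro κ ν y hth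
    have h3 : (if Through T μ x κ ν y then w κ ν y else 0) ≤ ∑ y' : Site (F.P K) 0, if Through T μ x κ ν y' then w κ ν y' else 0 :=
      Finset.single_le_sum (f := fun y' => if Through T μ x κ ν y' then w κ ν y' else 0)
        (fun y' _ => by split_ifs; exacts [hw0 κ ν y', le_rfl]) (Finset.mem_univ y)
    have h2 : (∑ y' : Site (F.P K) 0, if Through T μ x κ ν y' then w κ ν y' else 0)
        ≤ ∑ ν' : Fin (F.P K).d, ∑ y' : Site (F.P K) 0, if Through T μ x κ ν' y' then w κ ν' y' else 0 :=
      Finset.single_le_sum (f := fun ν' => ∑ y' : Site (F.P K) 0, if Through T μ x κ ν' y' then w κ ν' y' else 0)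
        (fun ν' _ => Finset.sum_nonneg fun y' _ => by split_ifs; exacts [hw0 κ ν' y', le_rfl]) (Finset.mem_univ ν)
    have h1 : (∑ ν' : Fin (F.P K).d, ∑ y' : Site (F.P K) 0, if Through T μ x κ ν' y' then w κ ν' y' else 0) ≤ S :=
      Finset.single_le_sum (f := fun κ' => ∑ ν' : Fin (F.P K).d, ∑ y' : Site (F.P K) 0, if Through T μ x κ' ν' y' then w κ' ν' y' else 0)
        (fun κ' _ => Finset.sum_nonneg fun ν' _ => Finset.sum_nonneg fun y' _ => by split_ifs; exacts [hw0 κ' ν' y', le_rfl])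
        (Finset.mem_univ κ)
    rw [if_pos hth] at h3
    exact h3.trans (h2.trans h1)
  have hsq : ∀ t : ℝ, 0 ≤ t → t ^ 2 ≤ S → t ≤ Real.sqrt S := fun t ht hts => by
    rw [← Real.sqrt_sq ht]
    exact Real.sqrt_le_sqrt hts
  have hA : ∀ κ ν y, Through T μ x κ ν y → ‖formComp X κ y‖ ≤ Real.sqrt S ∧ ‖formComp X ν (T κ y)‖ ≤ Real.sqrt S ∧
      ‖formComp X κ (T ν y)‖ ≤ Real.sqrt S ∧ ‖formComp X ν y‖ ≤ Real.sqrt S := by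
    intro κ ν y hth
    have hwS := hle κ ν y hth
    simp only [formComp]
    refine ⟨hsq _ (norm_nonneg _) ?_, hsq _ (norm_nonneg _) ?_, hsq _ (norm_nonneg _) ?_, hsq _ (norm_nonneg _) ?_⟩
    · have : ‖X ⟨y, κ⟩‖ ^ 2 ≤ w κ ν y := by
        rw [hw]; nlinarith [sq_nonneg ‖X ⟨T κ y, ν⟩‖, sq_nonneg ‖X ⟨T ν y, κ⟩‖, sq_nonneg ‖X ⟨y, ν⟩‖]
      exact this.trans hwS
    · have : ‖X ⟨T κ y, ν⟩‖ ^ 2 ≤ w κ ν y := by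
        rw [hw]; nlinarith [sq_nonneg ‖X ⟨y, κ⟩‖, sq_nonneg ‖X ⟨T ν y, κ⟩‖, sq_nonneg ‖X ⟨y, ν⟩‖]
      exact this.trans hwS
    · have : ‖X ⟨T ν y, κ⟩‖ ^ 2 ≤ w κ ν y := by
        rw [hw]; nlinarith [sq_nonneg ‖X ⟨y, κ⟩‖, sq_nonneg ‖X ⟨T κ y, ν⟩‖, sq_nonneg ‖X ⟨y, ν⟩‖]
      exact this.trans hwS
    · have : ‖X ⟨y, ν⟩‖ ^ 2 ≤ w κ ν y := by
        rw [hw]; nlinarith [sq_nonneg ‖X ⟨y, κ⟩‖, sq_nonneg ‖X ⟨T κ y, ν⟩‖, sq_nonneg ‖X ⟨T ν y, κ⟩‖]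
      exact this.trans hwS
  have hz' : ∀ κ ν y, Through T μ x κ ν y → ‖zP T U 1 κ ν y‖ ≤ ε₀ * eta F n K ^ 2 := fun κ ν y hth => hz κ ν y hth.1
  have hy' : ∀ κ ν y, Through T μ x κ ν y → ‖yP T U 1 κ ν y‖ ≤ ε₀ * eta F n K ^ 2 := fun κ ν y hth => hy κ ν y hth.1
  have h := norm_deltaPrimeOp_le_local_one T U hU1 μ x hA hz' hy'
  have hcard : ((Fintype.card (Fin (F.P K).d) - 1 : ℕ) : ℝ) = 2 := by
    rw [Fintype.card_fin, T3Family.P_d]; norm_num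
  rw [hcard] at h
  calc ‖deltaPrimeOp T U 1 (formComp X) μ x‖ ≤ 14 * (Real.sqrt S * (ε₀ * eta F n K ^ 2)) * 2 := h
    _ = 28 * (ε₀ * eta F n K ^ 2) * Real.sqrt S := by ring


/-- `Σ_y [c ∧ y = a]·f(y) = [c]·f(a)`. [folklore] -/
theorem sum_ite_and_eq_right {S : Type*} [Fintype S] [DecidableEq S] (c : Prop) [Decidable c] (a : S) (f : S → ℝ) :
    ∑ y : S, (if c ∧ y = a then f y else 0) = if c then f a else 0 := by
  by_cases hc : c
  · simp only [hc, true_and, if_true]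
    rw [Finset.sum_ite_eq' Finset.univ a f]
    simp
  · simp [hc]

open Classical in
/-- **THE DOUBLE COUNT**: summing the local sizes `a_b²` over all bonds counts every positively oriented plaquette at most four times (its four boundary bonds, the four cases of lit's
`Through`) and every bond at most `4d` times among the plaquette letters: `Σ_b a_b² ≤ 16d·Σ_b ‖X_b‖²`. [folklore] [cite: Balaban1985BackgroundPropagators, p.404 after (3.69)] -/
theorem sum_through_weights_le (X : PBond (F.P K) 0 → Matrix (Fin 2) (Fin 2) ℂ) :
    ∑ μ : Fin (F.P K).d, ∑ x : Site (F.P K) 0, ∑ κ : Fin (F.P K).d, ∑ ν : Fin (F.P K).d, ∑ y : Site (F.P K) 0,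
        (if Through (torusT (F.P K) 0) μ x κ ν y then
            ‖X ⟨y, κ⟩‖ ^ 2 + ‖X ⟨torusT (F.P K) 0 κ y, ν⟩‖ ^ 2 + ‖X ⟨torusT (F.P K) 0 ν y, κ⟩‖ ^ 2 + ‖X ⟨y, ν⟩‖ ^ 2
          else 0)
      ≤ 16 * (F.P K).d * ∑ b : PBond (F.P K) 0, ‖X b‖ ^ 2 := by
  set T := torusT (F.P K) 0 with hT
  set w : Fin (F.P K).d → Fin (F.P K).d → Site (F.P K) 0 → ℝ :=
    fun κ ν y => ‖X ⟨y, κ⟩‖ ^ 2 + ‖X ⟨T κ y, ν⟩‖ ^ 2 + ‖X ⟨T ν y, κ⟩‖ ^ 2 + ‖X ⟨y, ν⟩‖ ^ 2 with hw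
  have hw0 : ∀ κ ν y, 0 ≤ w κ ν y := fun κ ν y => by positivity
  -- Step 1: for fixed `(μ, x, κ, ν)` the `y`-sum sees at most the two sites `x`, `x − e_κ` (case `ν = μ`) or `x`, `x − e_ν` (case `κ = μ`)
  have step1 : ∀ μ x κ ν, (∑ y : Site (F.P K) 0, if Through T μ x κ ν y then w κ ν y else 0)
      ≤ (if ν = μ then w κ ν x + w κ ν ((T κ).symm x) else 0) + (if κ = μ then w κ ν x + w κ ν ((T ν).symm x) else 0) := by
    intro μ x κ ν
    have hpt : ∀ y, (if Through T μ x κ ν y then w κ ν y else 0)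
        ≤ (if ν = μ ∧ y = x then w κ ν y else 0) + (if ν = μ ∧ y = (T κ).symm x then w κ ν y else 0)
          + (if κ = μ ∧ y = x then w κ ν y else 0) + (if κ = μ ∧ y = (T ν).symm x then w κ ν y else 0) := by
      intro y
      have t1 : 0 ≤ (if ν = μ ∧ y = x then w κ ν y else 0) := by split_ifs; exacts [hw0 _ _ _, le_rfl]
      have t2 : 0 ≤ (if ν = μ ∧ y = (T κ).symm x then w κ ν y else 0) := by split_ifs; exacts [hw0 _ _ _, le_rfl]
      have t3 : 0 ≤ (if κ = μ ∧ y = x then w κ ν y else 0) := by split_ifs; exacts [hw0 _ _ _, le_rfl]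
      have t4 : 0 ≤ (if κ = μ ∧ y = (T ν).symm x then w κ ν y else 0) := by split_ifs; exacts [hw0 _ _ _, le_rfl]
      by_cases hth : Through T μ x κ ν y
      · rw [if_pos hth]
        rcases hth with ⟨_, (⟨hν, hy | hy⟩ | ⟨hκ, hy | hy⟩)⟩
        · have e : (if ν = μ ∧ y = x then w κ ν y else 0) = w κ ν y := if_pos ⟨hν, hy⟩
          linarith
        · have e : (if ν = μ ∧ y = (T κ).symm x then w κ ν y else 0) = w κ ν y := if_pos ⟨hν, hy⟩
          linarith
        · have e : (if κ = μ ∧ y = x then w κ ν y else 0) = w κ ν y := if_pos ⟨hκ, hy⟩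
          linarith
        · have e : (if κ = μ ∧ y = (T ν).symm x then w κ ν y else 0) = w κ ν y := if_pos ⟨hκ, hy⟩
          linarith
      · rw [if_neg hth]
        linarith
    calc (∑ y : Site (F.P K) 0, if Through T μ x κ ν y then w κ ν y else 0)
        ≤ ∑ y : Site (F.P K) 0, ((if ν = μ ∧ y = x then w κ ν y else 0) + (if ν = μ ∧ y = (T κ).symm x then w κ ν y else 0)
            + (if κ = μ ∧ y = x then w κ ν y else 0) + (if κ = μ ∧ y = (T ν).symm x then w κ ν y else 0)) :=
          Finset.sum_le_sum fun y _ => hpt y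
      _ = (if ν = μ then w κ ν x + w κ ν ((T κ).symm x) else 0) + (if κ = μ then w κ ν x + w κ ν ((T ν).symm x) else 0) := by
          simp only [Finset.sum_add_distrib, sum_ite_and_eq_right]
          split_ifs <;> ring
  -- Step 2: sum Step 1 over `(μ, x, κ, ν)`; the `ν = μ` (resp. `κ = μ`) indicator collapses one sum
  have hA : ∀ μ x, (∑ κ : Fin (F.P K).d, ∑ ν : Fin (F.P K).d, if ν = μ then w κ ν x + w κ ν ((T κ).symm x) else (0 : ℝ))
      = ∑ κ : Fin (F.P K).d, (w κ μ x + w κ μ ((T κ).symm x)) := by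
    intro μ x
    refine Finset.sum_congr rfl fun κ _ => ?_
    rw [Finset.sum_ite_eq' Finset.univ μ (fun ν => w κ ν x + w κ ν ((T κ).symm x)), if_pos (Finset.mem_univ μ)]
  have hB : ∀ μ x, (∑ κ : Fin (F.P K).d, ∑ ν : Fin (F.P K).d, if κ = μ then w κ ν x + w κ ν ((T ν).symm x) else (0 : ℝ))
      = ∑ ν : Fin (F.P K).d, (w μ ν x + w μ ν ((T ν).symm x)) := by
    intro μ x
    have e : ∀ κ, (∑ ν : Fin (F.P K).d, if κ = μ then w κ ν x + w κ ν ((T ν).symm x) else (0 : ℝ))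
        = if κ = μ then ∑ ν : Fin (F.P K).d, (w κ ν x + w κ ν ((T ν).symm x)) else 0 := by
      intro κ; split_ifs <;> simp
    simp_rw [e]
    rw [Finset.sum_ite_eq' Finset.univ μ (fun κ => ∑ ν : Fin (F.P K).d, (w κ ν x + w κ ν ((T ν).symm x))), if_pos (Finset.mem_univ μ)]
  -- the translated sums equal the untranslated ones
  have hshift : ∀ (κ ν : Fin (F.P K).d) (e : Equiv.Perm (Site (F.P K) 0)),
      ∑ x : Site (F.P K) 0, w κ ν (e.symm x) = ∑ x : Site (F.P K) 0, w κ ν x := fun κ ν e => Equiv.sum_comp e.symm (w κ ν)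
  set W : ℝ := ∑ κ : Fin (F.P K).d, ∑ ν : Fin (F.P K).d, ∑ x : Site (F.P K) 0, w κ ν x with hWdef
  have hsumA : ∑ μ : Fin (F.P K).d, ∑ x : Site (F.P K) 0, ∑ κ : Fin (F.P K).d, (w κ μ x + w κ μ ((T κ).symm x)) = 2 * W := by
    have e1 : ∀ μ : Fin (F.P K).d, ∑ x : Site (F.P K) 0, ∑ κ : Fin (F.P K).d, (w κ μ x + w κ μ ((T κ).symm x))
        = ∑ κ : Fin (F.P K).d, (2 * ∑ x : Site (F.P K) 0, w κ μ x) := by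
      intro μ
      rw [Finset.sum_comm]
      refine Finset.sum_congr rfl fun κ _ => ?_
      rw [Finset.sum_add_distrib, hshift κ μ (T κ), two_mul]
    simp_rw [e1]
    rw [hWdef, Finset.sum_comm, Finset.mul_sum]
    refine Finset.sum_congr rfl fun κ _ => ?_
    rw [Finset.mul_sum]
  have hsumB : ∑ μ : Fin (F.P K).d, ∑ x : Site (F.P K) 0, ∑ ν : Fin (F.P K).d, (w μ ν x + w μ ν ((T ν).symm x)) = 2 * W := by
    have e1 : ∀ μ : Fin (F.P K).d, ∑ x : Site (F.P K) 0, ∑ ν : Fin (F.P K).d, (w μ ν x + w μ ν ((T ν).symm x))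
        = ∑ ν : Fin (F.P K).d, (2 * ∑ x : Site (F.P K) 0, w μ ν x) := by
      intro μ
      rw [Finset.sum_comm]
      refine Finset.sum_congr rfl fun ν _ => ?_
      rw [Finset.sum_add_distrib, hshift μ ν (T ν), two_mul]
    simp_rw [e1]
    rw [hWdef, Finset.mul_sum]
    refine Finset.sum_congr rfl fun μ _ => ?_
    rw [Finset.mul_sum]
  -- Step 3: `W = 4d·Σ_b ‖X_b‖²`
  set S₀ : ℝ := ∑ κ : Fin (F.P K).d, ∑ x : Site (F.P K) 0, ‖X ⟨x, κ⟩‖ ^ 2 with hS₀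
  have hS₀b : ∑ b : PBond (F.P K) 0, ‖X b‖ ^ 2 = S₀ := by
    rw [sum_pbond_eq, hS₀, Finset.sum_comm]
  have hd : ∀ f : Fin (F.P K).d → ℝ, ∑ _ν : Fin (F.P K).d, ∑ κ : Fin (F.P K).d, f κ = (F.P K).d * ∑ κ : Fin (F.P K).d, f κ := by
    intro f; rw [Finset.sum_const, Finset.card_univ, Fintype.card_fin, nsmul_eq_mul]
  have hW : W = 4 * (F.P K).d * S₀ := by
    have e1 : W = ∑ κ : Fin (F.P K).d, ∑ ν : Fin (F.P K).d,
        ((∑ x : Site (F.P K) 0, ‖X ⟨x, κ⟩‖ ^ 2) + (∑ x : Site (F.P K) 0, ‖X ⟨x, ν⟩‖ ^ 2)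
          + (∑ x : Site (F.P K) 0, ‖X ⟨x, κ⟩‖ ^ 2) + (∑ x : Site (F.P K) 0, ‖X ⟨x, ν⟩‖ ^ 2)) := by
      rw [hWdef]
      refine Finset.sum_congr rfl fun κ _ => Finset.sum_congr rfl fun ν _ => ?_
      rw [hw]
      simp only [Finset.sum_add_distrib]
      rw [Equiv.sum_comp (T κ) (fun x => ‖X ⟨x, ν⟩‖ ^ 2), Equiv.sum_comp (T ν) (fun x => ‖X ⟨x, κ⟩‖ ^ 2)]
    rw [e1]
    simp only [Finset.sum_add_distrib]
    have eκ : ∑ κ : Fin (F.P K).d, ∑ _ν : Fin (F.P K).d, ∑ x : Site (F.P K) 0, ‖X ⟨x, κ⟩‖ ^ 2 = (F.P K).d * S₀ := by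
      rw [Finset.sum_comm, hd]
    have eν : ∑ _κ : Fin (F.P K).d, ∑ ν : Fin (F.P K).d, ∑ x : Site (F.P K) 0, ‖X ⟨x, ν⟩‖ ^ 2 = (F.P K).d * S₀ := by
      rw [hd]
    rw [eκ, eν]
    ring
  -- assemble
  calc ∑ μ : Fin (F.P K).d, ∑ x : Site (F.P K) 0, ∑ κ : Fin (F.P K).d, ∑ ν : Fin (F.P K).d, ∑ y : Site (F.P K) 0,
          (if Through T μ x κ ν y then w κ ν y else 0)
      ≤ ∑ μ : Fin (F.P K).d, ∑ x : Site (F.P K) 0, ∑ κ : Fin (F.P K).d, ∑ ν : Fin (F.P K).d,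
          ((if ν = μ then w κ ν x + w κ ν ((T κ).symm x) else 0) + (if κ = μ then w κ ν x + w κ ν ((T ν).symm x) else 0)) :=
        Finset.sum_le_sum fun μ _ => Finset.sum_le_sum fun x _ => Finset.sum_le_sum fun κ _ => Finset.sum_le_sum fun ν _ => step1 μ x κ ν
    _ = ∑ μ : Fin (F.P K).d, ∑ x : Site (F.P K) 0, ((∑ κ : Fin (F.P K).d, (w κ μ x + w κ μ ((T κ).symm x)))
          + ∑ ν : Fin (F.P K).d, (w μ ν x + w μ ν ((T ν).symm x))) := by
        refine Finset.sum_congr rfl fun μ _ => Finset.sum_congr rfl fun x _ => ?_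
        rw [← hA μ x, ← hB μ x, ← Finset.sum_add_distrib]
        refine Finset.sum_congr rfl fun κ _ => ?_
        rw [Finset.sum_add_distrib]
    _ = (∑ μ : Fin (F.P K).d, ∑ x : Site (F.P K) 0, ∑ κ : Fin (F.P K).d, (w κ μ x + w κ μ ((T κ).symm x)))
          + ∑ μ : Fin (F.P K).d, ∑ x : Site (F.P K) 0, ∑ ν : Fin (F.P K).d, (w μ ν x + w μ ν ((T ν).symm x)) := by
        simp only [Finset.sum_add_distrib]
    _ = 2 * W + 2 * W := by rw [hsumA, hsumB]
    _ = 16 * (F.P K).d * ∑ b : PBond (F.P K) 0, ‖X b‖ ^ 2 := by rw [hW, hS₀b]; ring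


/-- `|tr(XᴴY)| ≤ ‖X‖_F·‖Y‖_F` (Cauchy–Schwarz in `W₂`). [folklore] -/
theorem norm_trace_conjTranspose_mul_le (X Y : Matrix (Fin 2) (Fin 2) ℂ) :
    ‖Matrix.trace (X.conjTranspose * Y)‖ ≤ ‖(frobEquiv.symm X : W₂)‖ * ‖(frobEquiv.symm Y : W₂)‖ := by
  rw [← inner_frobEquiv_symm]
  exact norm_inner_le_norm _ _

open Classical in
/-- ★★ **`Δ′` IS `O(ε₀η²)` ON `L²`**: `|Σ_b tr(X_b† (Δ′₁X)_b)| ≤ 1029·(ε₀η²)·Σ_b ‖X_b‖_F²` on `RegPr F n K ε₀ U₀` — the local letter (3.69) in `ℓ²`-form (Cauchy–Schwarz per bond, AM–GM, the double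
count `Σ_b a_b² ≤ 16d·Σ‖X‖²`, `‖·‖_op ≤ ‖·‖_F ≤ √2‖·‖_op` on `M₂(ℂ)`, `d = 3`, `√2 ≤ 3∕2`): print's «Δ′ will be a bounded, small operator» (p.392) as an `L²` statement with an ABSOLUTE
constant. [cite: Balaban1985BackgroundPropagators, (3.10) p.392, (3.69) p.404] -/
theorem norm_sum_trace_conjTranspose_mul_deltaPrimeOp_le {ε₀ : ℝ} (hε₀ : 0 ≤ ε₀) (U₀ : GaugeField (F.P K) 0 (Matrix.specialUnitaryGroup (Fin 2) ℂ))
    (hreg : RegPr F n K ε₀ U₀) (X : PBond (F.P K) 0 → Matrix (Fin 2) (Fin 2) ℂ) :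
    ‖∑ b : PBond (F.P K) 0, Matrix.trace ((X b).conjTranspose
        * deltaPrimeOp (torusT (F.P K) 0) (fun μ x => bgUnits F K U₀ ⟨x, μ⟩) 1 (formComp X) b.dir b.src)‖
      ≤ 1029 * (ε₀ * eta F n K ^ 2) * ∑ b : PBond (F.P K) 0, ‖(frobEquiv.symm (X b) : W₂)‖ ^ 2 := by
  set T := torusT (F.P K) 0 with hT
  set U : Fin (F.P K).d → Site (F.P K) 0 → (Matrix (Fin 2) (Fin 2) ℂ)ˣ := fun μ x => bgUnits F K U₀ ⟨x, μ⟩ with hU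
  set δ : ℝ := ε₀ * eta F n K ^ 2 with hδ
  have hδ0 : 0 ≤ δ := by positivity
  set w : Fin (F.P K).d → Fin (F.P K).d → Site (F.P K) 0 → ℝ :=
    fun κ ν y => ‖X ⟨y, κ⟩‖ ^ 2 + ‖X ⟨T κ y, ν⟩‖ ^ 2 + ‖X ⟨T ν y, κ⟩‖ ^ 2 + ‖X ⟨y, ν⟩‖ ^ 2 with hw
  set S : Fin (F.P K).d → Site (F.P K) 0 → ℝ :=
    fun μ x => ∑ κ : Fin (F.P K).d, ∑ ν : Fin (F.P K).d, ∑ y : Site (F.P K) 0, if Through T μ x κ ν y then w κ ν y else 0 with hS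
  set SF : ℝ := ∑ b : PBond (F.P K) 0, ‖(frobEquiv.symm (X b) : W₂)‖ ^ 2 with hSF
  have hS0 : ∀ μ x, 0 ≤ S μ x := fun μ x => Finset.sum_nonneg fun κ _ => Finset.sum_nonneg fun ν _ => Finset.sum_nonneg fun y _ => by
    split_ifs
    · rw [hw]; positivity
    · exact le_rfl
  -- the local letter per bond
  have hloc : ∀ b : PBond (F.P K) 0, ‖deltaPrimeOp T U 1 (formComp X) b.dir b.src‖ ≤ 28 * δ * Real.sqrt (S b.dir b.src) := fun b =>
    norm_deltaPrimeOp_le_local_of_regPr U₀ hreg X b.dir b.src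
  -- per bond: `|tr(X_b†(Δ′X)_b)| ≤ 14√2·δ·(‖X_b‖_F² + S_b)`
  have hper : ∀ b : PBond (F.P K) 0, ‖Matrix.trace ((X b).conjTranspose * deltaPrimeOp T U 1 (formComp X) b.dir b.src)‖
      ≤ 14 * Real.sqrt 2 * δ * (‖(frobEquiv.symm (X b) : W₂)‖ ^ 2 + S b.dir b.src) := by
    intro b
    have h1 := norm_trace_conjTranspose_mul_le (X b) (deltaPrimeOp T U 1 (formComp X) b.dir b.src)
    have h2 : ‖(frobEquiv.symm (deltaPrimeOp T U 1 (formComp X) b.dir b.src) : W₂)‖ ≤ Real.sqrt 2 * (28 * δ * Real.sqrt (S b.dir b.src)) :=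
      (norm_frobEquiv_symm_le _).trans (mul_le_mul_of_nonneg_left (hloc b) (Real.sqrt_nonneg _))
    have hx0 : 0 ≤ ‖(frobEquiv.symm (X b) : W₂)‖ := norm_nonneg _
    have hs0 : 0 ≤ Real.sqrt (S b.dir b.src) := Real.sqrt_nonneg _
    have hsq : Real.sqrt (S b.dir b.src) ^ 2 = S b.dir b.src := Real.sq_sqrt (hS0 _ _)
    have hamgm : ‖(frobEquiv.symm (X b) : W₂)‖ * Real.sqrt (S b.dir b.src) ≤ (‖(frobEquiv.symm (X b) : W₂)‖ ^ 2 + S b.dir b.src) / 2 := by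
      have amgm : ∀ u v : ℝ, u * v ≤ (u ^ 2 + v ^ 2) / 2 := fun u v => by nlinarith [sq_nonneg (u - v)]
      have := amgm ‖(frobEquiv.symm (X b) : W₂)‖ (Real.sqrt (S b.dir b.src))
      rwa [hsq] at this
    calc ‖Matrix.trace ((X b).conjTranspose * deltaPrimeOp T U 1 (formComp X) b.dir b.src)‖
        ≤ ‖(frobEquiv.symm (X b) : W₂)‖ * (Real.sqrt 2 * (28 * δ * Real.sqrt (S b.dir b.src))) := h1.trans (mul_le_mul_of_nonneg_left h2 hx0)
      _ = 28 * Real.sqrt 2 * δ * (‖(frobEquiv.symm (X b) : W₂)‖ * Real.sqrt (S b.dir b.src)) := by ring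
      _ ≤ 28 * Real.sqrt 2 * δ * ((‖(frobEquiv.symm (X b) : W₂)‖ ^ 2 + S b.dir b.src) / 2) := mul_le_mul_of_nonneg_left hamgm (by positivity)
      _ = 14 * Real.sqrt 2 * δ * (‖(frobEquiv.symm (X b) : W₂)‖ ^ 2 + S b.dir b.src) := by ring
  -- the double count, with `‖·‖_op ≤ ‖·‖_F`
  have hsumS : ∑ b : PBond (F.P K) 0, S b.dir b.src ≤ 48 * SF := by
    have h1 : ∑ b : PBond (F.P K) 0, S b.dir b.src = ∑ μ : Fin (F.P K).d, ∑ x : Site (F.P K) 0, S μ x := by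
      rw [sum_pbond_eq, Finset.sum_comm]
    have h2 := sum_through_weights_le (F := F) (K := K) X
    have hd : ((F.P K).d : ℝ) = 3 := by rw [T3Family.P_d]; norm_num
    have h3 : ∑ b : PBond (F.P K) 0, ‖X b‖ ^ 2 ≤ SF :=
      Finset.sum_le_sum fun b _ => pow_le_pow_left₀ (norm_nonneg _) (norm_le_norm_frobEquiv_symm (X b)) 2
    rw [h1]
    calc ∑ μ : Fin (F.P K).d, ∑ x : Site (F.P K) 0, S μ x ≤ 16 * (F.P K).d * ∑ b : PBond (F.P K) 0, ‖X b‖ ^ 2 := h2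
      _ ≤ 16 * (F.P K).d * SF := mul_le_mul_of_nonneg_left h3 (by positivity)
      _ = 48 * SF := by rw [hd]; ring
  calc ‖∑ b : PBond (F.P K) 0, Matrix.trace ((X b).conjTranspose * deltaPrimeOp T U 1 (formComp X) b.dir b.src)‖
      ≤ ∑ b : PBond (F.P K) 0, ‖Matrix.trace ((X b).conjTranspose * deltaPrimeOp T U 1 (formComp X) b.dir b.src)‖ := norm_sum_le _ _
    _ ≤ ∑ b : PBond (F.P K) 0, 14 * Real.sqrt 2 * δ * (‖(frobEquiv.symm (X b) : W₂)‖ ^ 2 + S b.dir b.src) := Finset.sum_le_sum fun b _ => hper b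
    _ = 14 * Real.sqrt 2 * δ * (SF + ∑ b : PBond (F.P K) 0, S b.dir b.src) := by
        rw [← Finset.mul_sum, Finset.sum_add_distrib]
    _ ≤ 14 * Real.sqrt 2 * δ * (SF + 48 * SF) := by gcongr
    _ = (686 * Real.sqrt 2) * δ * SF := by ring
    _ ≤ (686 * (3 / 2)) * δ * SF := by
        have hSF : 0 ≤ SF := Finset.sum_nonneg fun b _ => sq_nonneg _
        have h2 : Real.sqrt 2 ≤ 3 / 2 := by
          rw [show (3 / 2 : ℝ) = Real.sqrt ((3 / 2) ^ 2) by rw [Real.sqrt_sq (by norm_num)]]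
          exact Real.sqrt_le_sqrt (by norm_num)
        gcongr
    _ = 1029 * (ε₀ * eta F n K ^ 2) * ∑ b : PBond (F.P K) 0, ‖(frobEquiv.symm (X b) : W₂)‖ ^ 2 := by rw [hδ, hSF]; ring

end Summit.QuantumFields.YangMills.Theorems.Prop7DeltaPrimeL2Bound

end
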